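import Mathlib
import Literature.NumberTheory.LFunctions.Zhang2022.Section7SjPolylog
import HarnessLib

/-!
# Zhang (2022) §7/§11: two mean values of the majorant `Λc = ∏_{q∣n}(1 + 12/q)` of `λ₀ⱼ`

Topic `Literature/NumberTheory/LFunctions/Zhang2022` (Landau–Siegel audit tree; verdict-neutral).
Y. Zhang, *Discrete mean estimates and the Landau–Siegel zero*, arXiv:2211.02515v1 (2022)
[Zhang2022LandauSiegel], §7 p. 33 (the arithmetic sums `S_j(𝐚₁,𝐚₂)` of Proposition 7.1, weights
`|μ(r)|λ₀ⱼ(dr)/(drφ(r))`) and §11 p. 64 (the window mean square "by (11.3), (8.25) and (8.26)",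
tex L3299) — **an unrefereed manuscript under adjudication** (lane ZHANG-L). The window bound for
`S_j` (leaves `Typed.TypedSection11B.Step11u019` / `Step11u019J2`, cell GAP row G-L3t10-1) splits
`λ₀ⱼ(dr)` by the tree's shift-free majorant `|λ₀ⱼ(dr)| ≤ Λc(d)Λc(r)`
(`XiZeroMajorant.norm_lamZero_le_LamC`, `LamC_mul_le`, file `Section7SjPolylog`) and then needs,
besides the logarithmic mean `Σ_{d≤X} Λc(d)/d ≪ log X` already in the tree (`sum_LamC_div_le`),
the two mean values PROVED here (helper H2 of the WP11 plan for the two leaves):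

* `sum_LamC_le` — **`Σ_{d≤W} Λc(d) ≤ e^{12 + 6S₀}·W`** for every `W` (`S₀ = LogEulerProduct.tailConst 0`):
  `Λc(d) = Σ_{k∣d} h(k)` with the squarefree kernel `h(k) = μ²(k)∏_{p∣k} 12/p`
  (`LamC_eq_sum_divisors_sqfreeKernel`: two multiplicative functions agreeing on prime powers), so
  `Σ_{d≤W} Λc(d) = Σ_{k≤W} h(k)⌊W/k⌋ ≤ W·Σ_{k≤W} h(k)/k ≤ W·e^{12+6S₀}` by the tree's Euler-product
  majorant `XiZeroMajorant.sum_div_le_gen` (Hall–Tenenbaum (0.4)) at `h(p) = 12/p`, `h(p^ν) ≤ 6`;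
* `sum_moebius_LamC_div_le` — **`Σ_{r≤X} |μ(r)|Λc(r)/(rφ(r)) ≤ e^{14 + 7S₀}`** for every `X`: the
  same majorant for the multiplicative `r ↦ |μ(r)|Λc(r)/φ(r)`, whose value at `p` is
  `(1 + 12/p)/(p − 1) ≤ 14/p` and which vanishes at higher prime powers; also spelled with `μ(r)²`
  (`sum_moebius_sq_LamC_div_le`).

Both come with the `∃ C` packaging (`exists_sum_LamC_le`, `exists_sum_moebius_LamC_div_le`). The
file declares no new objects (the kernel `h` and `|μ|Λc/φ` are written out inline); everything is
elementary. No statement about the manuscript's Theorems 1–2 or about Landau–Siegel zeros is made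
or implied.

## References

* Y. Zhang, arXiv:2211.02515v1 (2022), §7 Prop. 7.1 p. 33; §11 p. 64.
  [cite: Zhang2022LandauSiegel, §7 Prop. 7.1 p.33; §11 p.64]
* R. R. Hall, G. Tenenbaum, *Divisors* (CUP 1988), (0.4). [cite: HallTenenbaum1988, (0.4)]
-/

noncomputable section

open Finset Real ArithmeticFunction

namespace Literature.NumberTheory.LFunctions.Zhang2022.XiZeroMajorant

/-! ### The squarefree kernel of `Λc`: `Λc(d) = Σ_{k∣d} μ²(k)∏_{p∣k} 12/p` -/

/-- The squarefree kernel `h(k) = μ²(k)∏_{p∣k} 12/p` of `Λc` is multiplicative on coprime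
arguments. [cite: Zhang2022LandauSiegel, §7 p.33] -/
theorem sqfreeKernel_mul_of_coprime {m n : ℕ} (hm : m ≠ 0) (hn : n ≠ 0) (hmn : Nat.Coprime m n) :
    (if Squarefree (m * n) then ∏ p ∈ (m * n).primeFactors, 12 / (p : ℝ) else 0) =
      (if Squarefree m then ∏ p ∈ m.primeFactors, 12 / (p : ℝ) else 0) *
        (if Squarefree n then ∏ p ∈ n.primeFactors, 12 / (p : ℝ) else 0) := by
  by_cases hsq : Squarefree (m * n)
  · obtain ⟨hsm, hsn⟩ := (Nat.squarefree_mul hmn).1 hsq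
    rw [if_pos hsq, if_pos hsm, if_pos hsn, Nat.primeFactors_mul hm hn,
      prod_union (Nat.Coprime.disjoint_primeFactors hmn)]
  · rw [if_neg hsq]
    have : ¬ (Squarefree m ∧ Squarefree n) := fun h => hsq ((Nat.squarefree_mul hmn).2 h)
    rcases not_and_or.1 this with h | h
    · rw [if_neg h, zero_mul]
    · rw [if_neg h, mul_zero]

/-- At prime powers: `h(1) = 1`, `h(p) = 12/p`, `h(p^ν) = 0` for `ν ≥ 2`, written as one formula.
[cite: Zhang2022LandauSiegel, §7 p.33] -/
theorem sqfreeKernel_prime_pow {p : ℕ} (hp : p.Prime) (ν : ℕ) :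
    (if Squarefree (p ^ ν) then ∏ q ∈ (p ^ ν).primeFactors, 12 / (q : ℝ) else 0) =
      (if ν = 0 then (1 : ℝ) else 0) + (if ν = 1 then 12 / (p : ℝ) else 0) := by
  rcases Nat.lt_or_ge ν 2 with hν | hν
  · interval_cases ν
    · simp
    · simp [hp.squarefree, hp.primeFactors]
  · rw [if_neg, if_neg (by omega), if_neg (by omega), add_zero]
    rw [Nat.squarefree_pow_iff hp.ne_one (by omega)]
    rintro ⟨-, h⟩
    omega

/-- `0 ≤ h(p^ν) ≤ 6` at every prime power, and `0 ≤ h` everywhere.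
[cite: Zhang2022LandauSiegel, §7 p.33] -/
theorem sqfreeKernel_nonneg (k : ℕ) :
    0 ≤ (if Squarefree k then ∏ p ∈ k.primeFactors, 12 / (p : ℝ) else 0) := by
  split_ifs
  · exact prod_nonneg fun p _ => by positivity
  · exact le_rfl

/-- `h(p^ν) ≤ 6` at every prime power (`1`, `12/p ≤ 6`, or `0`). [cite: Zhang2022LandauSiegel, §7 p.33] -/
theorem sqfreeKernel_prime_pow_le {p : ℕ} (hp : p.Prime) (ν : ℕ) :
    (if Squarefree (p ^ ν) then ∏ q ∈ (p ^ ν).primeFactors, 12 / (q : ℝ) else 0) ≤ 6 := by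
  have hp2 : (2 : ℝ) ≤ p := by exact_mod_cast hp.two_le
  rw [sqfreeKernel_prime_pow hp]
  rcases Nat.lt_or_ge ν 2 with hν | hν
  · interval_cases ν
    · norm_num
    · simp only [one_ne_zero, ↓reduceIte, zero_add]
      rw [div_le_iff₀ (by linarith)]; linarith
  · rw [if_neg (by omega), if_neg (by omega)]; norm_num

/-- **`Λc(d) = Σ_{k∣d} μ²(k)∏_{p∣k}12/p`** for every `d` (`∏_{q∣d}(1 + 12/q)` expanded: the two
sides are multiplicative in `d` and agree at prime powers, `Λc(p^ν) = 1 + 12/p = h(1) + h(p)`).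
[cite: Zhang2022LandauSiegel, §7 p.33] -/
theorem LamC_eq_sum_divisors_sqfreeKernel (d : ℕ) :
    LamC d = ∑ k ∈ d.divisors, (if Squarefree k then ∏ p ∈ k.primeFactors, 12 / (p : ℝ) else 0) := by
  -- the kernel as an arithmetic function
  set h : ArithmeticFunction ℝ :=
    ⟨fun k => if k = 0 then 0 else if Squarefree k then ∏ p ∈ k.primeFactors, 12 / (p : ℝ) else 0,
      if_pos rfl⟩ with hh
  have h_apply : ∀ k : ℕ, k ≠ 0 →
      h k = if Squarefree k then ∏ p ∈ k.primeFactors, 12 / (p : ℝ) else 0 :=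
    fun k hk => by rw [hh]; exact if_neg hk
  have h_mult : h.IsMultiplicative := by
    rw [IsMultiplicative.iff_ne_zero]
    refine ⟨by rw [h_apply 1 one_ne_zero]; simp, fun {m n} hm hn hmn => ?_⟩
    rw [h_apply _ (mul_ne_zero hm hn), h_apply m hm, h_apply n hn]
    exact sqfreeKernel_mul_of_coprime hm hn hmn
  have key : LamC = h * (ArithmeticFunction.zeta : ArithmeticFunction ℝ) := by
    rw [IsMultiplicative.eq_iff_eq_on_prime_powers LamC isMultiplicative_LamC
      (h * (ArithmeticFunction.zeta : ArithmeticFunction ℝ))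
      (h_mult.mul isMultiplicative_zeta.natCast)]
    intro p i hp
    rw [coe_mul_zeta_apply, Nat.sum_divisors_prime_pow hp]
    have hx : ∀ x ∈ range (i + 1), h (p ^ x) =
        (if x = 0 then (1 : ℝ) else 0) + (if x = 1 then 12 / (p : ℝ) else 0) := by
      intro x _
      rw [h_apply _ (pow_ne_zero x hp.ne_zero)]
      exact sqfreeKernel_prime_pow hp x
    rw [sum_congr rfl hx, sum_add_distrib, sum_ite_eq', sum_ite_eq', if_pos (mem_range.2 (by omega))]
    rcases Nat.eq_zero_or_pos i with rfl | hi
    · rw [pow_zero, isMultiplicative_LamC.map_one, if_neg (by simp)]; simp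
    · rw [LamC_apply (pow_ne_zero i hp.ne_zero), Nat.primeFactors_prime_pow hi.ne' hp,
        prod_singleton, if_pos (mem_range.2 (by omega))]
  rw [key, coe_mul_zeta_apply]
  refine sum_congr rfl fun k hk => h_apply k ?_
  exact Nat.pos_iff_ne_zero.1 (Nat.pos_of_mem_divisors hk)

/-! ### H2a: `Σ_{d≤W} Λc(d) ≤ C·W` -/

/-- **`Σ_{k≤X} h(k)/k ≤ e^{12 + 6S₀}`** (`X ≥ 2`) for the squarefree kernel `h` of `Λc`: the
Euler-product majorant (Hall–Tenenbaum (0.4), tree `sum_div_le_gen`) at `h(p) = 12/p`, `h(p^ν) ≤ 6`;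
the bound is `∏_p(1 + 12/p²)`-sized and free of `log X`. [cite: HallTenenbaum1988, (0.4)] -/
theorem sum_sqfreeKernel_div_le {X : ℕ} (hX : 2 ≤ X) :
    ∑ k ∈ Icc 1 X, (if Squarefree k then ∏ p ∈ k.primeFactors, 12 / (p : ℝ) else 0) / k ≤
      Real.exp (12 + 6 * LogEulerProduct.tailConst 0) := by
  have h := sum_div_le_gen
    (f := fun k => if Squarefree k then ∏ p ∈ k.primeFactors, 12 / (p : ℝ) else 0)
    (by simp) (fun m n hmn => ?_) sqfreeKernel_nonneg (a := 0) (d := 0) (K := 0) (M := 12)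
    (C₅ := 6) le_rfl (by norm_num) (by norm_num) hX (fun p hp => ?_)
    (fun p hp _ => by simp [hp.squarefree, hp.primeFactors])
    (fun p ν hp _ => by rw [pow_zero, mul_one]; exact sqfreeKernel_prime_pow_le hp ν)
  · simpa using h
  · -- multiplicativity on coprime arguments (trivial if a factor vanishes)
    rcases eq_or_ne m 0 with rfl | hm
    · rcases eq_or_ne n 1 with rfl | hn1
      · simp
      · have : n = 1 := Nat.Coprime.eq_one_of_dvd (Nat.Coprime.symm hmn) (dvd_zero n) |>.symm ▸ rfl
        exact absurd this hn1
    rcases eq_or_ne n 0 with rfl | hn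
    · rcases eq_or_ne m 1 with rfl | hm1
      · simp
      · have : m = 1 := Nat.Coprime.eq_one_of_dvd hmn (dvd_zero m) |>.symm ▸ rfl
        exact absurd this hm1
    exact sqfreeKernel_mul_of_coprime hm hn hmn
  · -- the local series is dominated by `6·2^{−ν}`
    have hp2 : (2 : ℝ) ≤ p := by exact_mod_cast hp.two_le
    refine Summable.of_nonneg_of_le (fun ν => div_nonneg (sqfreeKernel_nonneg _) (by positivity))
      (fun ν => ?_) ((summable_geometric_of_lt_one (by norm_num : (0 : ℝ) ≤ 1 / 2)
        (by norm_num)).mul_left 6)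
    have hppos : (0 : ℝ) < (p : ℝ) ^ ν := by positivity
    rw [div_le_iff₀ hppos]
    have h1 : (1 : ℝ) ≤ (1 / 2 : ℝ) ^ ν * (p : ℝ) ^ ν := by
      rw [← mul_pow]; exact one_le_pow₀ (by linarith)
    calc (if Squarefree (p ^ ν) then ∏ q ∈ (p ^ ν).primeFactors, 12 / (q : ℝ) else 0)
        ≤ 6 := sqfreeKernel_prime_pow_le hp ν
      _ ≤ 6 * ((1 / 2 : ℝ) ^ ν * (p : ℝ) ^ ν) := le_mul_of_one_le_right (by norm_num) h1
      _ = 6 * (1 / 2 : ℝ) ^ ν * (p : ℝ) ^ ν := by ring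

/-- `Σ_{d≤W} Λc(d) = Σ_{k≤W} h(k)·⌊W/k⌋` (swap the divisor sum). [cite: Zhang2022LandauSiegel, §7 p.33] -/
theorem sum_LamC_eq_sum_sqfreeKernel_mul_div (W : ℕ) :
    ∑ d ∈ Icc 1 W, LamC d =
      ∑ k ∈ Icc 1 W, (if Squarefree k then ∏ p ∈ k.primeFactors, 12 / (p : ℝ) else 0) *
        ((W / k : ℕ) : ℝ) := by
  simp_rw [LamC_eq_sum_divisors_sqfreeKernel]
  rw [sum_comm' (t' := Icc 1 W) (s' := fun k => (Icc 1 W).filter (fun d => k ∣ d))]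
  · refine sum_congr rfl fun k hk => ?_
    rw [sum_const, nsmul_eq_mul, mul_comm]
    congr 1
    have hIcc : Icc 1 W = Ioc 0 W := rfl
    rw [hIcc, Nat.Ioc_filter_dvd_card_eq_div]
  · intro d k
    rw [mem_filter, mem_Icc, mem_Icc, Nat.mem_divisors]
    constructor
    · rintro ⟨⟨hd1, hdW⟩, hkd, hd0⟩
      have hk0 : 0 < k := Nat.pos_of_dvd_of_pos hkd (by omega)
      exact ⟨⟨⟨hd1, hdW⟩, hkd⟩, hk0, le_trans (Nat.le_of_dvd (by omega) hkd) hdW⟩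
    · rintro ⟨⟨⟨hd1, hdW⟩, hkd⟩, -, -⟩
      exact ⟨⟨hd1, hdW⟩, hkd, by omega⟩

/-- **H2a. `Σ_{d≤W} Λc(d) ≤ e^{12 + 6S₀}·W`** for every `W` (`Λc = ∏_{q∣d}(1 + 12/q)`, the tree's
majorant of `λ₀ⱼ`; `S₀ = LogEulerProduct.tailConst 0`). [cite: Zhang2022LandauSiegel, §7 Prop. 7.1 p.33; §11 p.64] -/
theorem sum_LamC_le (W : ℕ) :
    ∑ d ∈ Icc 1 W, LamC d ≤ Real.exp (12 + 6 * LogEulerProduct.tailConst 0) * W := by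
  set E : ℝ := Real.exp (12 + 6 * LogEulerProduct.tailConst 0) with hE
  have hE1 : 1 ≤ E := by
    rw [hE]; exact Real.one_le_exp (by linarith [LogEulerProduct.tailConst_nonneg 0])
  rcases Nat.lt_or_ge W 2 with hW | hW
  · interval_cases W
    · simp
    · rw [show Icc 1 1 = {1} by rfl, sum_singleton, isMultiplicative_LamC.map_one]
      simpa using hE1
  · rw [sum_LamC_eq_sum_sqfreeKernel_mul_div]
    have hWpos : (0 : ℝ) < W := by exact_mod_cast (by omega : 0 < W)
    calc ∑ k ∈ Icc 1 W, (if Squarefree k then ∏ p ∈ k.primeFactors, 12 / (p : ℝ) else 0) *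
            ((W / k : ℕ) : ℝ)
        ≤ ∑ k ∈ Icc 1 W, (W : ℝ) *
            ((if Squarefree k then ∏ p ∈ k.primeFactors, 12 / (p : ℝ) else 0) / k) := by
          refine sum_le_sum fun k hk => ?_
          have hk0 : (0 : ℝ) < k := by exact_mod_cast (mem_Icc.1 hk).1
          calc (if Squarefree k then ∏ p ∈ k.primeFactors, 12 / (p : ℝ) else 0) * ((W / k : ℕ) : ℝ)
              ≤ (if Squarefree k then ∏ p ∈ k.primeFactors, 12 / (p : ℝ) else 0) * ((W : ℝ) / k) :=
                mul_le_mul_of_nonneg_left (Nat.cast_div_le) (sqfreeKernel_nonneg k)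
            _ = (W : ℝ) * ((if Squarefree k then ∏ p ∈ k.primeFactors, 12 / (p : ℝ) else 0) / k) := by
                ring
      _ = (W : ℝ) * ∑ k ∈ Icc 1 W,
            (if Squarefree k then ∏ p ∈ k.primeFactors, 12 / (p : ℝ) else 0) / k := by rw [mul_sum]
      _ ≤ (W : ℝ) * E := mul_le_mul_of_nonneg_left (sum_sqfreeKernel_div_le hW) hWpos.le
      _ = E * W := mul_comm _ _

/-- **H2a, packaged**: `∃ C > 0, ∀ W, Σ_{d≤W} Λc(d) ≤ C·W`.
[cite: Zhang2022LandauSiegel, §7 Prop. 7.1 p.33; §11 p.64] -/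
theorem exists_sum_LamC_le : ∃ C : ℝ, 0 < C ∧ ∀ W : ℕ, ∑ d ∈ Icc 1 W, LamC d ≤ C * W :=
  ⟨_, Real.exp_pos _, sum_LamC_le⟩

/-! ### H2b: `Σ_{r≤X} |μ(r)|Λc(r)/(rφ(r)) ≤ C` -/

/-- At a prime: `|μ(p)|Λc(p)/φ(p) = (1 + 12/p)/(p − 1) ≤ 14/p`. [cite: Zhang2022LandauSiegel, §7 p.33] -/
theorem natAbs_moebius_mul_LamC_div_totient_prime_le {p : ℕ} (hp : p.Prime) :
    ((ArithmeticFunction.moebius p).natAbs : ℝ) * LamC p / (Nat.totient p : ℝ) ≤ 14 / (p : ℝ) := by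
  have hp2 : (2 : ℝ) ≤ p := by exact_mod_cast hp.two_le
  have hppos : (0 : ℝ) < p := by linarith
  rw [moebius_apply_prime hp, LamC_apply hp.ne_zero, hp.primeFactors, prod_singleton,
    Nat.totient_prime hp]
  have hφ : (((p - 1 : ℕ)) : ℝ) = (p : ℝ) - 1 := by
    rw [Nat.cast_sub hp.one_le]; simp
  rw [hφ]
  simp only [Int.reduceNeg, Int.natAbs_neg, Int.natAbs_one, Nat.cast_one, one_mul]
  rw [div_le_div_iff₀ (by linarith) hppos]
  have : (1 + 12 / (p : ℝ)) * p = p + 12 := by field_simp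
  rw [this]
  linarith

/-- `|μ(p^ν)|Λc(p^ν)/φ(p^ν) ≤ 7` at every prime power (`1`, `≤ 14/p ≤ 7`, or `0` for `ν ≥ 2`).
[cite: Zhang2022LandauSiegel, §7 p.33] -/
theorem natAbs_moebius_mul_LamC_div_totient_prime_pow_le {p : ℕ} (hp : p.Prime) (ν : ℕ) :
    ((ArithmeticFunction.moebius (p ^ ν)).natAbs : ℝ) * LamC (p ^ ν) / (Nat.totient (p ^ ν) : ℝ)
      ≤ 7 := by
  have hp2 : (2 : ℝ) ≤ p := by exact_mod_cast hp.two_le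
  rcases Nat.lt_or_ge ν 2 with hν | hν
  · interval_cases ν
    · rw [pow_zero, isMultiplicative_LamC.map_one, isMultiplicative_moebius.map_one]; simp
    · rw [pow_one]
      refine (natAbs_moebius_mul_LamC_div_totient_prime_le hp).trans ?_
      rw [div_le_iff₀ (by linarith)]; linarith
  · rw [moebius_apply_prime_pow hp (by omega), if_neg (by omega)]
    simp

/-- **H2b. `Σ_{r≤X} |μ(r)|Λc(r)/(rφ(r)) ≤ e^{14 + 7S₀}`** for every `X` (a convergent Euler product:
the summand at `p` is `≤ 14/p²`; Hall–Tenenbaum (0.4) via the tree's `sum_div_le_gen` applied to the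
multiplicative `r ↦ |μ(r)|Λc(r)/φ(r)`). [cite: Zhang2022LandauSiegel, §7 Prop. 7.1 p.33; §11 p.64] -/
theorem sum_moebius_LamC_div_le (X : ℕ) :
    ∑ r ∈ Icc 1 X, ((ArithmeticFunction.moebius r).natAbs : ℝ) * LamC r /
        ((r : ℝ) * (Nat.totient r : ℝ)) ≤ Real.exp (14 + 7 * LogEulerProduct.tailConst 0) := by
  set E : ℝ := Real.exp (14 + 7 * LogEulerProduct.tailConst 0) with hE
  have hE1 : 1 ≤ E := by
    rw [hE]; exact Real.one_le_exp (by linarith [LogEulerProduct.tailConst_nonneg 0])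
  -- the multiplicative function `f(r) = |μ(r)|Λc(r)/φ(r)`
  set f : ℕ → ℝ := fun r =>
    ((ArithmeticFunction.moebius r).natAbs : ℝ) * LamC r / (Nat.totient r : ℝ) with hf
  have hf0 : ∀ r, 0 ≤ f r := fun r =>
    div_nonneg (mul_nonneg (Nat.cast_nonneg _) (LamC_nonneg r)) (Nat.cast_nonneg _)
  have hf1 : f 1 = 1 := by
    rw [hf]; dsimp only
    rw [isMultiplicative_LamC.map_one, isMultiplicative_moebius.map_one]; simp
  have hfmul : ∀ m n : ℕ, Nat.Coprime m n → f (m * n) = f m * f n := by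
    intro m n hmn
    rw [hf]; dsimp only
    rcases eq_or_ne m 0 with rfl | hm
    · simp [LamC]
    rcases eq_or_ne n 0 with rfl | hn
    · simp [LamC]
    rw [isMultiplicative_moebius.map_mul_of_coprime hmn, Int.natAbs_mul, Nat.cast_mul,
      isMultiplicative_LamC.map_mul_of_coprime hmn, Nat.totient_mul hmn, Nat.cast_mul,
      div_mul_div_comm]
    ring
  have hfpow : ∀ p ν : ℕ, p.Prime → f (p ^ ν) ≤ 7 := fun p ν hp =>
    natAbs_moebius_mul_LamC_div_totient_prime_pow_le hp ν
  have hfsum : ∀ p : ℕ, p.Prime → Summable fun ν : ℕ => f (p ^ ν) / (p : ℝ) ^ ν := by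
    intro p hp
    have hp2 : (2 : ℝ) ≤ p := by exact_mod_cast hp.two_le
    refine Summable.of_nonneg_of_le (fun ν => div_nonneg (hf0 _) (by positivity))
      (fun ν => ?_) ((summable_geometric_of_lt_one (by norm_num : (0 : ℝ) ≤ 1 / 2)
        (by norm_num)).mul_left 7)
    have hppos : (0 : ℝ) < (p : ℝ) ^ ν := by positivity
    rw [div_le_iff₀ hppos]
    have h1 : (1 : ℝ) ≤ (1 / 2 : ℝ) ^ ν * (p : ℝ) ^ ν := by
      rw [← mul_pow]; exact one_le_pow₀ (by linarith)
    calc f (p ^ ν) ≤ 7 := hfpow p ν hp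
      _ ≤ 7 * ((1 / 2 : ℝ) ^ ν * (p : ℝ) ^ ν) := le_mul_of_one_le_right (by norm_num) h1
      _ = 7 * (1 / 2 : ℝ) ^ ν * (p : ℝ) ^ ν := by ring
  -- rewrite the summand as `f r / r`
  have hterm : ∀ r ∈ Icc 1 X, ((ArithmeticFunction.moebius r).natAbs : ℝ) * LamC r /
      ((r : ℝ) * (Nat.totient r : ℝ)) = f r / r := by
    intro r _
    rw [hf]; dsimp only
    rw [div_div, mul_comm (Nat.totient r : ℝ)]
  rw [sum_congr rfl hterm]
  rcases Nat.lt_or_ge X 2 with hX | hX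
  · interval_cases X
    · simp; linarith
    · rw [show Icc 1 1 = {1} by rfl, sum_singleton, hf1]
      simpa using hE1
  · have h := sum_div_le_gen (f := f) hf1 hfmul hf0 (a := 0) (d := 0) (K := 0) (M := 14)
      (C₅ := 7) le_rfl (by norm_num) (by norm_num) hX hfsum
      (fun p hp _ => by
        have := natAbs_moebius_mul_LamC_div_totient_prime_le hp
        push_cast; rw [hf]; dsimp only; linarith)
      (fun p ν hp _ => by rw [pow_zero, mul_one]; exact hfpow p ν hp)
    simpa using h

/-- **H2b, packaged**: `∃ C > 0, ∀ X, Σ_{r≤X} |μ(r)|Λc(r)/(rφ(r)) ≤ C`.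
[cite: Zhang2022LandauSiegel, §7 Prop. 7.1 p.33; §11 p.64] -/
theorem exists_sum_moebius_LamC_div_le : ∃ C : ℝ, 0 < C ∧ ∀ X : ℕ,
    ∑ r ∈ Icc 1 X, ((ArithmeticFunction.moebius r).natAbs : ℝ) * LamC r /
        ((r : ℝ) * (Nat.totient r : ℝ)) ≤ C :=
  ⟨_, Real.exp_pos _, sum_moebius_LamC_div_le⟩

/-- **H2b with `μ²`**: since `|μ(r)| ∈ {0,1}`, `|μ(r)| = μ(r)²`, so the same bound holds for
`Σ_{r≤X} μ(r)²Λc(r)/(rφ(r))`. [cite: Zhang2022LandauSiegel, §7 Prop. 7.1 p.33; §11 p.64] -/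
theorem sum_moebius_sq_LamC_div_le (X : ℕ) :
    ∑ r ∈ Icc 1 X, ((ArithmeticFunction.moebius r : ℝ)) ^ 2 * LamC r /
        ((r : ℝ) * (Nat.totient r : ℝ)) ≤ Real.exp (14 + 7 * LogEulerProduct.tailConst 0) := by
  refine le_trans (le_of_eq (sum_congr rfl fun r _ => ?_)) (sum_moebius_LamC_div_le X)
  congr 2
  have h : ((ArithmeticFunction.moebius r : ℤ) : ℝ) ^ 2 =
      (((ArithmeticFunction.moebius r).natAbs : ℤ) : ℝ) ^ 2 := by
    rw [Int.natCast_natAbs, Int.cast_abs, sq_abs]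
  rw [h, Int.cast_natCast]
  -- `|μ r| ∈ {0, 1}`, so its square is itself
  have h01 : (ArithmeticFunction.moebius r).natAbs ≤ 1 := by
    have := ArithmeticFunction.abs_moebius_le_one (n := r)
    rw [← Int.natCast_natAbs] at this
    exact_mod_cast this
  interval_cases (ArithmeticFunction.moebius r).natAbs <;> norm_num

end Literature.NumberTheory.LFunctions.Zhang2022.XiZeroMajorant
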